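import Summits.QuantumAdvantage.QuantumAdvantage.Theorems.CubicForrelationNearExactIsExactConcatAveraging

/-!
# Crux `CubicForrelation.NearExactIsExact` (stmt-QuantumAdvantage-14043) — the general codimension-`k` concatenation identity

Line `direct-sum-amplification`, helper (tag CC4, lead c1).  The tree's `bb_forrelation_concat`
(Theorems/CubicForrelationNearExactIsExactConcatAveraging.lean) evaluates `Φ` of ONE particular 4-concatenation
pattern (`c ‖ d₁ ‖ d₁ ‖ ¬c` against `g₁ ‖ g₂ ‖ g₂ ‖ ¬g₁`).  Here is the general identity it is an instance of:
for ANY Boolean `f, g` on `n + k` bits, writing `f_ξ := f(· ‖ ξ)` and `g_η := g(· ‖ η)` for the `2^k`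
restrictions to the cosets of the first `n` coordinates (`ξ, η ∈ {0,1}^k`),

  `Φ(f, g) = 2^{-3k/2} · Σ_{ξ, η} (-1)^{ξ·η} · Φ(f_ξ, g_η)`        (`cc_forrelation_concat`),

in particular for `k = 2` (`√(2^6) = 8`):

  `Φ(f, g) = (1/8) · Σ_{ξ, η ∈ {0,1}²} (-1)^{ξ·η} Φ(f_ξ, g_η)`      (`cc_forrelation_concat_two`).

So the value of a codimension-2 concatenated pair is one eighth of the `H₄`-weighted sum of the `4 × 4` matrix of
piece forrelations `M_{ξη} = Φ(f_ξ, g_η)` (`H₄ = ((-1)^{ξ·η})`); near-exactness of `(f, g)` is a statement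
about `M` being close to an `H₄`-extremal pattern (e.g. `M = ½ H₄ ∘ (exact)`), and the averaging lemma
`bb_forrelation_concat` is the pattern that uses eight of the sixteen entries.  `f` is cubic iff
`f_ξ = a ⊕ ξ₁ b₁ ⊕ ξ₂ b₂ ⊕ ξ₁ξ₂ c` with `a` cubic, `bᵢ` quadratic, `c` affine (not needed for the identity).

Proof: split both sums over `n + k` coordinates into block sums (`sum_append`), factor the twist
(`twist_append`) and the normalisation `√(2^{3(n+k)}) = √(2^{3n}) √(2^{3k})` (`sqrt_two_pow_three_mul_add`), and
reorder.  Sources: S. Aaronson, A. Ambainis, Forrelation, SIAM J. Comput. 47 (2018) §1.1.1 (definition of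
`Φ`); C. Carlet, Boolean Functions for Cryptography and Coding Theory (2021) §6.1.16 (4-decompositions /
concatenations of bent functions) — orientation only; everything is proved from the definition.
Imports: the landed ConcatAveraging file (for `bb_sqrt_two_pow_six` and the forrelation vocabulary); the Theses file is deliberately NOT imported.
-/

set_option linter.dupNamespace false -- D-0017: single-problem summit

namespace Summit.QuantumAdvantage.QuantumAdvantage.Theorems.CubicForrelation.NearExactIsExact

open Finset
open Literature.Computability.QuantumComplexity

variable {n : ℕ}

/-- **The general concatenation identity.** For all Boolean `f, g` on `n + k` bits,
`Φ(f,g) = (√(2^{3k}))⁻¹ · Σ_{ξ,η ∈ {0,1}^k} (-1)^{ξ·η} Φ(f(·‖ξ), g(·‖η))`. -/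
theorem cc_forrelation_concat :
    ∀ {n k : ℕ} (f g : (Fin (n + k) → Bool) → Bool), forrelation f g = (Real.sqrt ((2 : ℝ) ^ (3 * k)))⁻¹ *
      ∑ ξ : Fin k → Bool, ∑ η : Fin k → Bool, twist ξ η *
        forrelation (fun x₁ : Fin n → Bool => f (Fin.append x₁ ξ)) (fun y₁ : Fin n → Bool => g (Fin.append y₁ η)) := by
  intro n k f g
  unfold forrelation
  rw [sqrt_two_pow_three_mul_add]
  simp_rw [sum_append]
  simp only [twist_append]
  have h1 : Real.sqrt ((2 : ℝ) ^ (3 * n)) ≠ 0 := by positivity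
  have h2 : Real.sqrt ((2 : ℝ) ^ (3 * k)) ≠ 0 := by positivity
  -- move the block sums over `ξ` (second coordinate block of `x`) and `η` outside
  have swap : ∑ x₁ : Fin n → Bool, ∑ ξ : Fin k → Bool, ∑ y₁ : Fin n → Bool, ∑ η : Fin k → Bool,
        signOf (f (Fin.append x₁ ξ)) * (twist x₁ y₁ * twist ξ η) * signOf (g (Fin.append y₁ η)) =
      ∑ ξ : Fin k → Bool, ∑ η : Fin k → Bool, twist ξ η *
        ∑ x₁ : Fin n → Bool, ∑ y₁ : Fin n → Bool,
          signOf (f (Fin.append x₁ ξ)) * twist x₁ y₁ * signOf (g (Fin.append y₁ η)) := by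
    rw [sum_comm]
    refine sum_congr rfl fun ξ _ => ?_
    simp_rw [mul_sum]
    rw [sum_congr rfl fun x₁ _ => sum_comm]
    rw [sum_comm]
    refine sum_congr rfl fun η _ => sum_congr rfl fun x₁ _ => sum_congr rfl fun y₁ _ => ?_
    ring
  rw [swap, mul_sum, mul_sum]
  refine sum_congr rfl fun ξ _ => ?_
  rw [mul_sum, mul_sum]
  refine sum_congr rfl fun η _ => ?_
  field_simp

/-- **Codimension two** (`k = 2`): `Φ(f,g) = (1/8) Σ_{ξ,η ∈ {0,1}²} (-1)^{ξ·η} Φ(f_ξ, g_η)` — the sixteen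
piece-forrelations weighted by the `4 × 4` Hadamard pattern. -/
theorem cc_forrelation_concat_two (f g : (Fin (n + 2) → Bool) → Bool) :
    forrelation f g = (1 / 8 : ℝ) *
      ∑ ξ : Fin 2 → Bool, ∑ η : Fin 2 → Bool, twist ξ η *
        forrelation (fun x₁ : Fin n → Bool => f (Fin.append x₁ ξ)) (fun y₁ : Fin n → Bool => g (Fin.append y₁ η)) := by
  rw [cc_forrelation_concat, bb_sqrt_two_pow_six]
  norm_num

/-- **Codimension one** (`k = 1`): `Φ(f,g) = (Φ(f₀,g₀) + Φ(f₀,g₁) + Φ(f₁,g₀) − Φ(f₁,g₁)) / √8` — in particular a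
pair on an ODD number of bits `n + 1` built from pieces on `n` bits; with all four piece values equal to `1`
except `Φ(f₁,g₁) = −1` this is `4/√8 = √2 > 1`, which is how one sees that the four pieces of a pair cannot be
chosen independently. -/
theorem cc_forrelation_concat_one (f g : (Fin (n + 1) → Bool) → Bool) :
    forrelation f g = (Real.sqrt 8)⁻¹ *
      ∑ ξ : Fin 1 → Bool, ∑ η : Fin 1 → Bool, twist ξ η *
        forrelation (fun x₁ : Fin n → Bool => f (Fin.append x₁ ξ)) (fun y₁ : Fin n → Bool => g (Fin.append y₁ η)) := by
  rw [cc_forrelation_concat]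
  norm_num

end Summit.QuantumAdvantage.QuantumAdvantage.Theorems.CubicForrelation.NearExactIsExact
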